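-- PORT certsdp.sos.kstream v3 (certnum-sdp-3, K-STREAM lane; staged/filed by gridfusion-sos-5 ksstage3.py) / source cert/B/NE39field-l10-d2-B-claimA24.json sha256: a191950ba00db60e45fee46f6b876823b8acfd3926a460cdb88627e4597bf64f
import Summits.Ventures.GridStability.Bench.NE39KsVdotNegTwin
-- EMITTED by certsdp.sos.kstream (certnum-sdp-3, K-STREAM lane) from pub/gridfusion/cert/B/NE39field-l10-d2-B-claimA24.json
-- (gridfusion-sos-2, toolchain B, file sha16 9f5e030f76c77133), identity Vdot_neg; CLAIM instance NE39field-l10-d2-A24-claim (0c624682d8a79771).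
-- HONEST FRAMING: these files re-derive IN THE KERNEL the algebraic inequality p ≥ 0 on {g ≥ 0} ∩ {h = 0} of that identity;
-- they assert nothing about stability (the ROA reading is the client's Lyapunov/transport lemma on MODEL M′); module names/namespace are placeholders for the filing seat.
/-!
# Ventures/GridStability — K-STREAM kernel set for «G2.b-dense-NE39field-l10-d2», identity Vdot_neg — `NE39KsVdotNegTwinR2`

Twin PSD certificate, row range 2 of 4.
-/

namespace Summit.Ventures.GridStability.Bench.NE39Ks

open Literature.Computation.Certificates.SOS.Keyed Literature.Computation.Certificates Literature.Computation.Certificates.SOS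

noncomputable section

/-- kernel: residual rows 100–199 of the twin are diagonally dominant [folklore] -/
theorem NE39KsVdotNegTwinR2_ok : PSD.Packed.checkRowsRange 53 26 62 32675433 NE39KsVdotNeg_M.flatten NE39KsVdotNeg_d NE39KsVdotNeg_C 100 100 = true := by decide +kernel

end

end Summit.Ventures.GridStability.Bench.NE39Ks
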